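import Mathlib.Tactic
import HarnessLib

/-!
# Kozma–Nitzan's Question 8 at three relays — THEOREM SSC(U): the algebraic kernels (gen 27)

Support file (`--supports stmt-CriticalPhenomena-4575`, closed crux; independent mathematics on Kozma–Nitzan's Question 8,
arXiv:2401.12397 §5.5 p. 36), prover `prim-ineq-gen-6` (gen 27).  No definitions, no named facts, no sorries; standard axioms.
Memo `run/shared/lean/prim/prim-ineq-gen-6/PROOF-SSC-U-G27.md`.

THEOREM SSC(U) (memo): for every path-end block of the κ = 2 one-block C3 problem the depths `j` with `U_j > 0` (positive
subtree sums of the class density `G₀`) form an initial segment — the second link of the chain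
SSC(κ̂) → SSC(U) → SSC(δ) → DICHOTOMY D → L0 → C3 (c > 0) of FINDING-G25 §5b (SSC(κ̂) is gen 26's theorem).
With `Ũ_j := −U_j/s_{j+1} = u″L̃_j + v″R̃_j − Γ_j u″v″` (the κ̂-shape with corrected coefficients) and the EMISSIONS
`η_k := ρ_k U_k/(a_kγ_kp_k)` one has `L̃_j = a_jL_j − a_jΣ_{k<j}(γ_k−γ_j)η_k`, `R̃_j = γ_jR_j − γ_jΣ_{k<j}(a_k−a_j)η_k`,
`Π̃_j = a_jγ_j(Π′_j − Σ_{k≤j}η_k)`; the proof bounds the cumulative positive emission `H_j = Σ_{k≤j}η_k⁺` by a quarter of the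
near share of the budget `B := Φ²m/(Φ+m) ≤ Φπ − c` (PROPOSITION H: `H_j ≤ (1−S_{j+1})B/4`, via the quarter trick
`quarter_trick` and the emission bound `emission_bound`, induction step `propH_step`), spends the far share on the shallow far
C-channel (`budget_split`), derives the transfer inequality (♣~) (`club_tilde_of_bounds`) and closes with the exact step theorem
`utilde_step` (THEOREM 7~, the corrected form of gen 26's `kappahat_step_identity`).  Every identity and inequality is exact-checked
on > 10⁵ (block, depth) pairs (lab-g27/r04, kit proofcheckU).
[cite: KozmaNitzan2024, Question 8 (§5.5 p. 36)]
-/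

namespace Summit.CriticalPhenomena.PercolationContinuityZ3.Theorems

namespace PocketCert

/-- **Quarter trick.**  At a depth with `U = s·[v(Γu − R̃) − uL̃]`, the channel bound `k·v ≤ R̃` (LEMMA R~ rearranged,
`k = γ(Φ+m)u″/m″ > 0`) gives `v(Γu − R̃) − uL̃ ≤ (Γu)²/(4k) − uL̃` (AM–GM on `R̃(Γu − R̃)`).
[cite: KozmaNitzan2024, Question 8 (§5.5 p. 36)] -/
theorem quarter_trick (v R G L u k : ℝ) (hk : 0 < k) (hv : 0 ≤ v) (hkv : k * v ≤ R) :
    v * (G * u - R) - u * L ≤ (G * u) ^ 2 / (4 * k) - u * L := by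
  have hsq : 0 ≤ (G * u) ^ 2 / (4 * k) := by positivity
  rcases le_or_gt (G * u - R) 0 with h | h
  · -- nonpositive slope: v(Gu − R) ≤ 0
    have : v * (G * u - R) ≤ 0 := mul_nonpos_of_nonneg_of_nonpos hv h
    linarith
  · -- v ≤ R/k and R(Gu − R) ≤ (Gu)²/4
    have hvle : v ≤ R / k := by rw [le_div_iff₀ hk]; linarith
    have h1 : v * (G * u - R) ≤ R / k * (G * u - R) := mul_le_mul_of_nonneg_right hvle h.le
    have h2 : R / k * (G * u - R) = R * (G * u - R) / k := by ring
    have h3 : R * (G * u - R) ≤ (G * u) ^ 2 / 4 := by nlinarith [sq_nonneg (G * u - 2 * R)]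
    have h4 : R * (G * u - R) / k ≤ (G * u) ^ 2 / 4 / k := div_le_div_of_nonneg_right h3 hk.le
    have h5 : (G * u) ^ 2 / 4 / k = (G * u) ^ 2 / (4 * k) := by rw [div_div]
    linarith

/-- **Emission bound (LEMMA E core).**  With `a2S = a_j²S_{j+1} ≤ 1`, `θ = H_{j−1}/B ≤ 3/4` and `γ ≤ 1`:
`(a2S/4)·B − (1−γ)(1−θ)·B ≤ γ·(a2S/4)·B` — the function `γ ↦ [(a2S/4) − (1−γ)(1−θ)]/γ` is non-decreasing, so the positive
emission is largest at `γ = 1`: no lower bound on `γ` is needed. [cite: KozmaNitzan2024, Question 8 (§5.5 p. 36)] -/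
theorem emission_bound (γ a2S θ B : ℝ) (hγ1 : γ ≤ 1) (ha1 : a2S ≤ 1) (hθ : θ ≤ 3 / 4) (hB : 0 ≤ B) :
    a2S / 4 * B - (1 - γ) * (1 - θ) * B ≤ γ * (a2S / 4 * B) := by
  -- (1−γ)·[(1−θ) − a2S/4]·B ≥ 0
  have h1 : 0 ≤ 1 - γ := by linarith
  have h2 : 0 ≤ (1 - θ) - a2S / 4 := by linarith
  have h3 : 0 ≤ (1 - γ) * ((1 - θ) - a2S / 4) * B := mul_nonneg (mul_nonneg h1 h2) hB
  have e : γ * (a2S / 4 * B) - (a2S / 4 * B - (1 - γ) * (1 - θ) * B) = (1 - γ) * ((1 - θ) - a2S / 4) * B := by ring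
  linarith

/-- **PROPOSITION H, induction step.**  If `H ≤ (1−S)B/4` (cumulative positive emission before depth `j`, `S = S_j`) and the
depth-`j` emission satisfies `η ≤ (1−s)(S·s)B/4` (LEMMA E with `a_j²u″/p_j ≤ 1`, `s = s_{j+1}`, `S·s = S_{j+1}`), then
`H + η ≤ (1 − S·s)B/4`, because `(1−s)S s ≤ ω_j = S(1−s)`. [cite: KozmaNitzan2024, Question 8 (§5.5 p. 36)] -/
theorem propH_step (H η S s B : ℝ) (hS0 : 0 ≤ S) (hB : 0 ≤ B)
    (hH : H ≤ (1 - S) * B / 4) (hη : η ≤ (1 - s) * (S * s) * B / 4) :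
    H + η ≤ (1 - S * s) * B / 4 := by
  have h1 : 0 ≤ S * (1 - s) ^ 2 * B := mul_nonneg (mul_nonneg hS0 (sq_nonneg _)) hB
  have e : (1 - S * s) * B / 4 - ((1 - S) * B / 4 + (1 - s) * (S * s) * B / 4) = S * (1 - s) ^ 2 * B / 4 := by ring
  linarith

/-- **LEMMA R~ (corrected far coefficient stays above `γK₄`).**  From the emission identity
`R̃ = γ[(1−a)K₃ + aK₄ − Σ_{k<j}(a_k−a_j)η_k] ≥ γ[(1−a)(K₃ − H) + aK₄]` with `K₃ = X + K₄`, `H ≤ X`, and then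
`K₄ = (Φ+m)(1−Φ) ≥ (Φ+m)J″ ≥ (Φ+m)u″v″/m″` (Chebyshev on the suffix), one gets `R̃ ≥ γ(Φ+m)u″v″/m″`, i.e. `k·v″ ≤ R̃`.
[cite: KozmaNitzan2024, Question 8 (§5.5 p. 36)] -/
theorem Rtilde_lower (Rt γ a K3 K4 X H Pm J u v m2 : ℝ) (hγ : 0 ≤ γ) (ha1 : a ≤ 1)
    (hRt : γ * ((1 - a) * (K3 - H) + a * K4) ≤ Rt) (hK3 : K3 = X + K4) (hH : H ≤ X)
    (hK4 : Pm * J ≤ K4) (hJ : u * v ≤ J * m2) (hPm : 0 ≤ Pm) (hm2 : 0 < m2) :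
    γ * Pm * u * v / m2 ≤ Rt := by
  have h0 : 0 ≤ (1 - a) * (X - H) := mul_nonneg (sub_nonneg.2 ha1) (sub_nonneg.2 hH)
  have h1 : K4 ≤ (1 - a) * (K3 - H) + a * K4 := by
    have e : (1 - a) * (K3 - H) + a * K4 - K4 = (1 - a) * (X - H) := by rw [hK3]; ring
    linarith
  have h2 : γ * K4 ≤ Rt := le_trans (mul_le_mul_of_nonneg_left h1 hγ) hRt
  have h3 : Pm * (u * v) ≤ Pm * (J * m2) := mul_le_mul_of_nonneg_left hJ hPm
  have h4 : Pm * J * m2 ≤ K4 * m2 := mul_le_mul_of_nonneg_right hK4 hm2.le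
  have h5 : γ * (Pm * u * v) ≤ γ * (K4 * m2) := mul_le_mul_of_nonneg_left (by linarith) hγ
  have h6 : γ * K4 * m2 ≤ Rt * m2 := mul_le_mul_of_nonneg_right h2 hm2.le
  rw [div_le_iff₀ hm2]
  linarith

/-- **Budget split.**  The near share pays the corrections, the far share pays the shallow far C-channel:
`H_j ≤ (1−S_{j+1})B/4`, `ΦD″_i < S_{i+1}a_i²B`, `S_{i+1} ≤ S_{j+1} ≤ 1`, `a_i² ≤ 1`, `B ≤ Φπ − c` give `H_j + ΦD″_i < Φπ − c`.
[cite: KozmaNitzan2024, Question 8 (§5.5 p. 36)] -/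
theorem budget_split (H D S1 S2 a2 B P : ℝ) (hB : 0 ≤ B) (hS2 : 0 ≤ S2) (hS21 : S2 ≤ S1) (hS1 : S1 ≤ 1)
    (ha1 : a2 ≤ 1) (hH : H ≤ (1 - S1) * B / 4) (hD : D < S2 * a2 * B) (hBP : B ≤ P) : H + D < P := by
  have h0 : S2 * a2 ≤ S2 := mul_le_of_le_one_right hS2 ha1
  have h1 : S2 * a2 * B ≤ S1 * B := mul_le_mul_of_nonneg_right (by linarith) hB
  have h2 : S1 * B ≤ B := by
    have := mul_le_mul_of_nonneg_right hS1 hB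
    linarith
  linarith

/-- **(♣~) from the bounds.**  At a positive depth `i = j+1` (vertex `b` with marks `A, C`): from `Ũ_i < 0` one has
`C·v·R̃_j ≤ v·R̃_i < u·(Γ_i v − L̃_i)` with `L̃_i = A(L̃_j + (1−C)Π̃_j)`; the coefficient bounds `Π̃_j ≥ aγ(P − H)`,
`L̃_j ≥ a(1−γ)(P − H)` (emission identities, `P = Φπ − c`, `H = H_j`) and the shallow far channel `A·Γ_i·v = a·A²·ΦD″_i`,
`0 ≤ ΦD″_i < P − H` (budget split) give the transfer inequality `A·R̃_j·v < u·Π̃_j`.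
[cite: KozmaNitzan2024, Question 8 (§5.5 p. 36)] -/
theorem club_tilde_of_bounds (A C a γ u v Rj Li Lj Pj Gv P H PD : ℝ) (hA : 0 < A) (hA1 : A ≤ 1) (hC : 0 < C)
    (hC1 : C ≤ 1) (ha : 0 < a) (hγ0 : 0 ≤ γ) (hu : 0 < u)
    (hneg : C * v * Rj < u * (Gv - Li)) (hLi : Li = A * (Lj + (1 - C) * Pj)) (hPj : a * γ * (P - H) ≤ Pj)
    (hLj : a * (1 - γ) * (P - H) ≤ Lj) (hGv : A * Gv = a * A ^ 2 * PD) (hPD0 : 0 ≤ PD) (hPD : PD < P - H) :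
    A * Rj * v < u * Pj := by
  have hPH : 0 < P - H := by linarith
  have hA2 : A ^ 2 ≤ 1 := pow_le_one₀ hA.le hA1
  -- (i) the main-term bound: a A² (P − H) ≤ C Π̃_j + A L̃_i
  have key : a * A ^ 2 * (P - H) ≤ C * Pj + A * Li := by
    rw [hLi]
    -- C Pj + A²(Lj + (1−C)Pj) ≥ (P−H)·a·[Cγ + A²(1−γ) + A²(1−C)γ] ≥ (P−H)·a·A²
    have e1 : C * (a * γ * (P - H)) + A ^ 2 * (a * (1 - γ) * (P - H) + (1 - C) * (a * γ * (P - H)))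
              - a * A ^ 2 * (P - H) = a * (P - H) * C * γ * (1 - A ^ 2) := by ring
    have hpos : 0 ≤ a * (P - H) * C * γ * (1 - A ^ 2) :=
      mul_nonneg (mul_nonneg (mul_nonneg (mul_nonneg ha.le hPH.le) hC.le) hγ0) (sub_nonneg.2 hA2)
    have m1 : C * (a * γ * (P - H)) ≤ C * Pj := mul_le_mul_of_nonneg_left hPj hC.le
    have m3 : (1 - C) * (a * γ * (P - H)) ≤ (1 - C) * Pj := mul_le_mul_of_nonneg_left hPj (sub_nonneg.2 hC1)
    have m2 : A ^ 2 * (a * (1 - γ) * (P - H) + (1 - C) * (a * γ * (P - H))) ≤ A ^ 2 * (Lj + (1 - C) * Pj) :=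
      mul_le_mul_of_nonneg_left (by linarith) (sq_nonneg A)
    have e2 : A * (A * (Lj + (1 - C) * Pj)) = A ^ 2 * (Lj + (1 - C) * Pj) := by ring
    linarith
  -- (ii) A (Gv − Li) < C Pj  since A Gv = a A² PD < a A² (P − H) ≤ C Pj + A Li
  have hii : A * (Gv - Li) < C * Pj := by
    have h1 : a * A ^ 2 * PD < a * A ^ 2 * (P - H) := mul_lt_mul_of_pos_left hPD (by positivity)
    have e : A * (Gv - Li) = A * Gv - A * Li := by ring
    linarith
  -- combine: A C v Rj ≤ u A (Gv − Li) < u C Pj, divide by C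
  have h1 : A * (C * v * Rj) ≤ A * (u * (Gv - Li)) := mul_le_mul_of_nonneg_left hneg.le hA.le
  have h2 : u * (A * (Gv - Li)) < u * (C * Pj) := mul_lt_mul_of_pos_left hii hu
  have h3 : C * (A * Rj * v) < C * (u * Pj) := by
    have e1 : C * (A * Rj * v) = A * (C * v * Rj) := by ring
    have e2 : A * (u * (Gv - Li)) = u * (A * (Gv - Li)) := by ring
    have e3 : u * (C * Pj) = C * (u * Pj) := by ring
    linarith
  exact lt_of_mul_lt_mul_left h3 hC.le

/-- **THEOREM 7~ (the SSC(U) step, exact form).**  Depth `j → i = j+1` across the vertex `b = b_i` (marks `A, C`), edge weight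
`s = s_{i+1}`, `mt = (1−s)Φ‴ + s m‴ ≥ 0`, channels `u, v` of `T_{i+1}`; the channels of `T_i` are `ui = C((1−A)mt + s u)` and
`vi = A((1−C)mt + s v)`; corrected coefficients update as `Li = A(Lj + (1−C)Pj)`, `Ri = C(Rj + (1−A)Xj)`, and
`Γ_i = G·A²C·s` (`G = Γ_j`).  If `Lj, Rj, Pj, Xj ≥ 0`, `Ũ_i = u Li + v Ri − Γ_i u v < 0` and (♣~) `A Rj v ≤ u Pj`, then
`Ũ_j = ui Lj + vi Rj − G ui vi < 0`, i.e. `U_i > 0 ⟹ U_{i−1} > 0`.  Proof: gen 26's exact step identity (re-proved by `ring`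
in the corrected variables) and the two remainder bounds of the memo §4. [cite: KozmaNitzan2024, Question 8 (§5.5 p. 36)] -/
theorem utilde_step (A C s G Lj Rj Pj Xj u v mt Li Ri ui vi : ℝ) (hA : 0 < A) (hA1 : A ≤ 1) (hC0 : 0 ≤ C) (hC1 : C ≤ 1)
    (hs : 0 < s) (hmt : 0 ≤ mt) (hG : 0 ≤ G) (hLj : 0 ≤ Lj) (hRj : 0 ≤ Rj) (hPj : 0 ≤ Pj) (hXj : 0 ≤ Xj)
    (hu : 0 < u) (hv : 0 < v)
    (hLi : Li = A * (Lj + (1 - C) * Pj)) (hRi : Ri = C * (Rj + (1 - A) * Xj))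
    (hui : ui = C * ((1 - A) * mt + s * u)) (hvi : vi = A * ((1 - C) * mt + s * v))
    (hneg : u * Li + v * Ri - G * A ^ 2 * C * s * u * v < 0) (hclub : A * Rj * v ≤ u * Pj) :
    ui * Lj + vi * Rj - G * ui * vi < 0 := by
  -- the exact step identity (gen 26 `kappahat_step_identity` with a = γ = 1, Φ S := Γ_j)
  have ident : A * (ui * Lj + vi * Rj - G * ui * vi)
      = s * ((u * Li + v * Ri - G * A ^ 2 * C * s * u * v) - A * u * (1 - C) * (Lj + Pj) + v * (A ^ 2 * Rj - Ri))
        + A * mt * (C * (1 - A) * Lj + A * (1 - C) * Rj - G * s * A * C * ((1 - A) * v + (1 - C) * u))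
        - A * mt ^ 2 * (G * A * C * (1 - A) * (1 - C)) := by
    rw [hLi, hRi, hui, hvi]; ring
  -- auxiliary coefficient bounds
  have hA2 : A ^ 2 ≤ 1 := pow_le_one₀ hA.le hA1
  have hA2C : A ^ 2 * Rj - Ri ≤ A ^ 2 * (1 - C) * Rj := by
    -- A²Rj − C Rj − C(1−A)Xj ≤ (A² − C)Rj ≤ A²(1−C)Rj
    have f1 : 0 ≤ C * (1 - A) * Xj := mul_nonneg (mul_nonneg hC0 (sub_nonneg.2 hA1)) hXj
    have f2 : 0 ≤ C * (1 - A ^ 2) * Rj := mul_nonneg (mul_nonneg hC0 (sub_nonneg.2 hA2)) hRj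
    have e : A ^ 2 * (1 - C) * Rj - (A ^ 2 * Rj - Ri) = C * (1 - A ^ 2) * Rj + C * (1 - A) * Xj := by rw [hRi]; ring
    linarith
  have hLiAC : A * C * Lj ≤ Li := by
    have f : 0 ≤ A * (1 - C) * (Lj + Pj) := mul_nonneg (mul_nonneg hA.le (sub_nonneg.2 hC1)) (add_nonneg hLj hPj)
    have e : Li - A * C * Lj = A * (1 - C) * (Lj + Pj) := by rw [hLi]; ring
    linarith
  have hLiP : A * (1 - C) * Pj ≤ Li := by
    have f : 0 ≤ A * Lj := mul_nonneg hA.le hLj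
    have e : Li - A * (1 - C) * Pj = A * Lj := by rw [hLi]; ring
    linarith
  have hRi0 : 0 ≤ Ri := by
    rw [hRi]; exact mul_nonneg hC0 (add_nonneg hRj (mul_nonneg (sub_nonneg.2 hA1) hXj))
  -- remainder 1: the bracket is ≤ Ũ_i < 0
  have hBR : -(A * u * (1 - C) * (Lj + Pj)) + v * (A ^ 2 * Rj - Ri) ≤ 0 := by
    have t1 : v * (A ^ 2 * Rj - Ri) ≤ v * (A ^ 2 * (1 - C) * Rj) := mul_le_mul_of_nonneg_left hA2C hv.le
    have t2 : 0 ≤ A * u * (1 - C) * Lj := mul_nonneg (mul_nonneg (mul_nonneg hA.le hu.le) (sub_nonneg.2 hC1)) hLj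
    have t3 : A * (1 - C) * (A * Rj * v) ≤ A * (1 - C) * (u * Pj) :=
      mul_le_mul_of_nonneg_left hclub (mul_nonneg hA.le (sub_nonneg.2 hC1))
    have e1 : v * (A ^ 2 * (1 - C) * Rj) = A * (1 - C) * (A * Rj * v) := by ring
    have e2 : A * u * (1 - C) * (Lj + Pj) = A * u * (1 - C) * Lj + A * (1 - C) * (u * Pj) := by ring
    linarith
  -- remainder 2: l0 ≤ 0
  have hl0 : C * (1 - A) * Lj + A * (1 - C) * Rj - G * s * A * C * ((1 - A) * v + (1 - C) * u) ≤ 0 := by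
    have hUi' : u * Li + v * Ri < (G * s * A * C) * A * u * v := by
      have e : (G * s * A * C) * A * u * v = G * A ^ 2 * C * s * u * v := by ring
      linarith
    have hW : 0 ≤ (1 - A) * v + (1 - C) * u :=
      add_nonneg (mul_nonneg (sub_nonneg.2 hA1) hv.le) (mul_nonneg (sub_nonneg.2 hC1) hu.le)
    have e1 : A * u * v * (C * (1 - A) * Lj + A * (1 - C) * Rj - G * s * A * C * ((1 - A) * v + (1 - C) * u))
        = A * u * v * (C * (1 - A) * Lj + A * (1 - C) * Rj) - ((G * s * A * C) * A * u * v) * ((1 - A) * v + (1 - C) * u) := by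
      ring
    have e2 : A * u * v * (C * (1 - A) * Lj + A * (1 - C) * Rj) - (u * Li + v * Ri) * ((1 - A) * v + (1 - C) * u)
        = (1 - A) * (A * C * u * v * Lj - u * v * Li - v ^ 2 * Ri) + (1 - C) * (A ^ 2 * u * v * Rj - u ^ 2 * Li - u * v * Ri) := by
      ring
    have step1 : A * u * v * (C * (1 - A) * Lj + A * (1 - C) * Rj - G * s * A * C * ((1 - A) * v + (1 - C) * u))
        ≤ (1 - A) * (A * C * u * v * Lj - u * v * Li - v ^ 2 * Ri) + (1 - C) * (A ^ 2 * u * v * Rj - u ^ 2 * Li - u * v * Ri) := by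
      rw [e1, ← e2]
      have : (u * Li + v * Ri) * ((1 - A) * v + (1 - C) * u) ≤ ((G * s * A * C) * A * u * v) * ((1 - A) * v + (1 - C) * u) :=
        mul_le_mul_of_nonneg_right hUi'.le hW
      linarith
    have b1 : A * C * u * v * Lj - u * v * Li - v ^ 2 * Ri ≤ 0 := by
      have t : u * v * (A * C * Lj) ≤ u * v * Li := mul_le_mul_of_nonneg_left hLiAC (mul_nonneg hu.le hv.le)
      have f : 0 ≤ v ^ 2 * Ri := mul_nonneg (sq_nonneg v) hRi0
      have e : u * v * (A * C * Lj) = A * C * u * v * Lj := by ring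
      linarith
    have b2 : A ^ 2 * u * v * Rj - u ^ 2 * Li - u * v * Ri ≤ 0 := by
      have t1 : u * v * (A ^ 2 * Rj - Ri) ≤ u * v * (A ^ 2 * (1 - C) * Rj) :=
        mul_le_mul_of_nonneg_left hA2C (mul_nonneg hu.le hv.le)
      have t2 : u ^ 2 * (A * (1 - C) * Pj) ≤ u ^ 2 * Li := mul_le_mul_of_nonneg_left hLiP (sq_nonneg u)
      have t3 : (1 - C) * A * u * (A * Rj * v) ≤ (1 - C) * A * u * (u * Pj) :=
        mul_le_mul_of_nonneg_left hclub (mul_nonneg (mul_nonneg (sub_nonneg.2 hC1) hA.le) hu.le)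
      have e1 : u * v * (A ^ 2 * Rj - Ri) = A ^ 2 * u * v * Rj - u * v * Ri := by ring
      have e2 : u * v * (A ^ 2 * (1 - C) * Rj) = (1 - C) * A * u * (A * Rj * v) := by ring
      have e3 : (1 - C) * A * u * (u * Pj) = u ^ 2 * (A * (1 - C) * Pj) := by ring
      linarith
    have b1' : (1 - A) * (A * C * u * v * Lj - u * v * Li - v ^ 2 * Ri) ≤ 0 :=
      mul_nonpos_of_nonneg_of_nonpos (sub_nonneg.2 hA1) b1
    have b2' : (1 - C) * (A ^ 2 * u * v * Rj - u ^ 2 * Li - u * v * Ri) ≤ 0 :=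
      mul_nonpos_of_nonneg_of_nonpos (sub_nonneg.2 hC1) b2
    have hAuv : 0 < A * u * v := by positivity
    have hprod : A * u * v * (C * (1 - A) * Lj + A * (1 - C) * Rj - G * s * A * C * ((1 - A) * v + (1 - C) * u)) ≤ 0 := by
      linarith
    by_contra hc
    have hc' := not_le.mp hc
    have : 0 < A * u * v * (C * (1 - A) * Lj + A * (1 - C) * Rj - G * s * A * C * ((1 - A) * v + (1 - C) * u)) :=
      mul_pos hAuv hc'
    linarith
  -- conclusion: A·Ũ_j ≤ s·Ũ_i < 0
  have hm2 : 0 ≤ A * mt ^ 2 * (G * A * C * (1 - A) * (1 - C)) :=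
    mul_nonneg (mul_nonneg hA.le (sq_nonneg mt))
      (mul_nonneg (mul_nonneg (mul_nonneg (mul_nonneg hG hA.le) hC0) (sub_nonneg.2 hA1)) (sub_nonneg.2 hC1))
  have hmid : A * mt * (C * (1 - A) * Lj + A * (1 - C) * Rj - G * s * A * C * ((1 - A) * v + (1 - C) * u)) ≤ 0 :=
    mul_nonpos_of_nonneg_of_nonpos (mul_nonneg hA.le hmt) hl0
  have hsBR : s * ((u * Li + v * Ri - G * A ^ 2 * C * s * u * v) - A * u * (1 - C) * (Lj + Pj) + v * (A ^ 2 * Rj - Ri)) < 0 := by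
    have h1 : (u * Li + v * Ri - G * A ^ 2 * C * s * u * v) - A * u * (1 - C) * (Lj + Pj) + v * (A ^ 2 * Rj - Ri)
        ≤ u * Li + v * Ri - G * A ^ 2 * C * s * u * v := by linarith
    have h2 : s * ((u * Li + v * Ri - G * A ^ 2 * C * s * u * v) - A * u * (1 - C) * (Lj + Pj) + v * (A ^ 2 * Rj - Ri))
        ≤ s * (u * Li + v * Ri - G * A ^ 2 * C * s * u * v) := mul_le_mul_of_nonneg_left h1 hs.le
    have h3 : s * (u * Li + v * Ri - G * A ^ 2 * C * s * u * v) < 0 := mul_neg_of_pos_of_neg hs hneg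
    linarith
  have hfin : A * (ui * Lj + vi * Rj - G * ui * vi) < 0 := by rw [ident]; linarith
  by_contra hcon
  have : 0 ≤ A * (ui * Lj + vi * Rj - G * ui * vi) := mul_nonneg hA.le (not_lt.mp hcon)
  linarith

end PocketCert

end Summit.CriticalPhenomena.PercolationContinuityZ3.Theorems
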